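/-
Copyright (c) 2026 the pub-hodgecm-mathlib formalisation cell (harness21).  Prover seat hodgecm-mathlib-R90-CS-p03 (g0) for R90-TF section S8 «ContSpec-n½» (planner R90-CS-plan (g0), hand
T2-(iii) (L-ORTH)): the LEVEL-`K′` twin of ★ `K2E1TruncatedEisensteinCuspOrthogonalCMTwo` (3a) and of ★ `K2E1SphericalEisensteinResidueOrthogonalCMTwo.horth_cm_two_of_letters` (3b).
-/
import Summits.HodgeConjecture.HodgeConjecture.Theorems.K2E1SphericalEisensteinResidueOrthogonalCMTwo   -- ★ part 3b (spherical head) + ★ part 3a `K2E1TruncatedEisensteinCuspOrthogonalCMTwo` (`exists_tsum_enorm_lowIndicator_le_cm_two`, the majorant at the constant section) + the generic ★ `K2E1SphericalEisensteinResidueOrthogonalU` (§1 Hilbert, §2 Siegel indicator), ★ FILE A∕B, (β1)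
import Summits.HodgeConjecture.HodgeConjecture.Theorems.K2E1TruncatedEisensteinBoundedCMTwo             -- ★ `eisensteinSeriesU_flatSectionU_arithmeticSubgroup_mul`, ★ `measurable_borelConstantTerm` (N-generic §1 of ★ `…BoundedCMThree`), ★ R4a `continuous_eisensteinSeriesU_flatSectionU_cm_two`
import Literature.NumberTheory.Automorphic.UnitaryGroupBorelConstantTermInvariance                       -- ★ `borelConstantTerm_rational_borel_mul_of_rational_invariant` (`E_B` is left-`B(L⁺)`-invariant)
import Literature.NumberTheory.Automorphic.UnitaryGroupUnipotentUnimodularThree                          -- ★ `borelConstantTerm_unipotent_mul_of_isMulRightInvariant` (`E_B` is left-`N(𝔸)`-invariant)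
import HarnessLib

/-!
# K2·E1 ∕ R90·S8 — `K2E1TruncatedEisensteinCuspOrthogonalLevelCMTwo` (T2-(iii), the letter (L-ORTH) at LEVEL `K′`, `U(1,1)_{L/L⁺}`):
# **`⟪φ̂, [Λ^T E(φ₁H^z)]⟫ = 0` FOR EVERY CUSP FORM `φ`, `1 < Re z`, `T ≥ 1`, AND `⟪Res + κ·[𝟙_{T<w₁}], φ̂⟫ = 0` FOR THE RESIDUE CLASS — FOR A LEVEL-`K′` SECTION `φ₁`**

Cell `pub/hodgecm-mathlib`, crux h413 = `stmt-HodgeConjecture-24833`, route of record `HCCMUnconditional`; R90-TF section S8 «ContSpec-n½», socket S8B#4 road («`L²_res(U(Φ₂)) = ⊕ ℂ·ψ∘det`»,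
T-letters of K2E1-p10's T1 `K2E1EisensteinResidueLevelConstantU2`).  THEOREMS ONLY (no `def`, no `instance`, no notation, no named-fact hypothesis, no `sorry`; default heartbeats); lane
`--supports stmt-HodgeConjecture-24833 --as helper` (count-neutral).  Closes no socket.

WHAT REPLACES THE CONSTANT SECTION `fun _ => φ₀` of ★ 3a: (i′) the tail is `Mf := E_B(E(f_z)) − f_z` POINTWISE (left-`B(L⁺)`∕`N(𝔸)`-invariant and Borel by ★
`borelConstantTerm_rational_borel_mul_of_rational_invariant` ∕ ★ `borelConstantTerm_unipotent_mul_of_isMulRightInvariant` ∕ ★ `measurable_borelConstantTerm`) plus ONE NEW LETTER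
`hMbd : ‖E_B(E(f_z))(g) − f_z(g)‖ ≤ C` on `{T < H}` ([MoeglinWaldspurger1995] II.1.7; discharged by ★ `K2E1EisensteinConstantTermIntertwinedBoundLevelU2`, R90-C14-p01); (ii′) the low part
is DOMINATED by the constant section `fun _ => (M : ℂ)` (`‖φ₁‖ ≤ M ≤ ‖(M:ℂ)‖`), so ★ `exists_tsum_enorm_lowIndicator_le_cm_two` applies verbatim at `φ₀ := (M:ℂ)` and the (Tr) letter is
the SPHERICAL `Λ^T E((M:ℂ)H^{Re z}) ∈ L²(μ)`; (iii′) the Godement majorant ★ `summable_eisensteinSeriesU_flatSectionU_cm_two` at `(φ := φ₁) (M := M)`.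
* §1 **`inner_cuspFormsToLp_eq_zero_of_ae_eq_truncation_level_cm_two`** — `⟪φ̂, v⟫ = 0` for every `L²` class `v =ᵐ Λ^T E(φ₁H^z)`, `1 < Re z` (★ 3a's proof re-keyed at (i′)(ii′)(iii′));
* §2 **`horth_level_cm_two_of_letters`** — THE LETTER (L-ORTH): `⟪Res + κ•[𝟙_{T<w₁}], φ̂⟫ = 0` for every cusp form `φ ∈ cuspForms μ 𝔓`, for the operator road's holomorphic family
  `F z =ᵐ Λ^T(Ec z)` with `Ec z = E(φ₁H^z)` on the tube (★ 3b's proof verbatim, the (Tr) letter now the spherical `hTr`, the tail letter `hMbd` quantified over the tube points of `D`);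
  **`horth_level_cm_two_of_letters₀`** — the same at the one-radical datum `𝔓₀ = ⟨PUnit, fun _ => N(𝔸)⟩`, whose conclusion is T1's (L-ORTH) TYPE token for token.
HONEST LABEL: HC_CM is proved only modulo the 7 printed citations (2 remaining named inputs: hLiu418 = `stmt-HodgeConjecture-24832`, h413 = `stmt-HodgeConjecture-24833`) until rung 0
closes; this file asserts no named fact and closes no socket; the heads are CONDITIONAL on the letters `hMbd` (tail bound), `hTr`∕`hL2` (spherical (Tr)), `(F, hFd, hFam)`, `(Ec, D, hE2)`, `hRes`.
References: [MoeglinWaldspurger1995] I.2.13, II.1.7–II.1.8, IV.1.11 · [BernsteinLapid2019] §4 p. 10 · [Garrett2018] §2.10–§2.11 · [BorelJacquet1979] §4.4–§4.6.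
-/

set_option autoImplicit false
-- the mandated namespace repeats the single-problem summit's segment (`HodgeConjecture.HodgeConjecture`)
set_option linter.dupNamespace false

noncomputable section

open MeasureTheory Measure NumberField IsDedekindDomain Set Filter Topology MulAction
open scoped ENNReal NNReal InnerProductSpace ComplexConjugate
open Literature.MeasureTheory.Group Literature.NumberTheory
open Literature.NumberTheory.Automorphic Literature.NumberTheory.Automorphic.UnitaryGroup AdelicGroupData
open Summit.HodgeConjecture.HodgeConjecture.Cruxes.H413.K2E1BorelEisensteinU
open Summit.HodgeConjecture.HodgeConjecture.Cruxes.H413.K2E1BorelCosetsDictionary (eisensteinSeriesU_eq_tsum_arithmeticBorelQuot forall_arithmeticBorel_iff)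
open Summit.HodgeConjecture.HodgeConjecture.Cruxes.H413.K2E1TruncatedEisensteinExplicit
open Summit.HodgeConjecture.HodgeConjecture.Cruxes.H413.K2E1MaassSelbergBracketsThree (measurable_flatSectionU)
open Summit.HodgeConjecture.HodgeConjecture.Cruxes.H413.K2E1BLEisensteinCuspOrthogonalU
open Summit.HodgeConjecture.HodgeConjecture.Cruxes.H413.K2E1BLEisensteinInWeightedSpaceU2 (lintegral_weight_enorm_mul_lt_top_of_lintegral_quotient_lt_top exists_isCoveringWeight_arithmeticBorel)
open Summit.HodgeConjecture.HodgeConjecture.Cruxes.H413.K2E1CuspConditionDictionaryU (invQuot_package_of_mem_cuspForms)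
open Summit.HodgeConjecture.HodgeConjecture.Cruxes.H413.K2E1BorelEisensteinGodementCMTwo (summable_eisensteinSeriesU_flatSectionU_cm_two)
open Summit.HodgeConjecture.HodgeConjecture.Cruxes.H413.K2E1SphericalHeckeEigenSectionU2 (norm_borelHeight_cpow continuous_borelHeight_cpow borelHeight_coe_pos)
open Summit.HodgeConjecture.HodgeConjecture.Cruxes.H413.K2E1BLBorelSpacesU2Defs
open Summit.HodgeConjecture.HodgeConjecture.Cruxes.H413.K2E1SphericalEisensteinResidueOrthogonalU
open Summit.HodgeConjecture.HodgeConjecture.Cruxes.H413.K2E1TruncatedEisensteinCuspOrthogonalCMTwo (exists_tsum_enorm_lowIndicator_le_cm_two)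
open Summit.HodgeConjecture.HodgeConjecture.Cruxes.H413.K2E1SphericalEisensteinResidueOrthogonalCMTwo (inner_cuspFormsToLp_eq_zero_of_ae_eq_siegelIndicator_cm_two)
open Summit.HodgeConjecture.HodgeConjecture.Cruxes.H413.K2E1TruncatedEisensteinBoundedCMThree (eisensteinSeriesU_flatSectionU_arithmeticSubgroup_mul measurable_borelConstantTerm)
open Summit.HodgeConjecture.HodgeConjecture.Cruxes.H413.K2E1BorelEisensteinRegularU (continuous_eisensteinSeriesU_flatSectionU_cm_two)
open Summit.HodgeConjecture.HodgeConjecture.Cruxes.H413.K2E1UnipotentHaarNormalisationU2 (isInvInvariant_of_isHaarMeasure_two)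

namespace Summit.HodgeConjecture.HodgeConjecture.Cruxes.H413.K2E1TruncatedEisensteinCuspOrthogonalLevelCMTwo

variable (L : Type) [Field L] [NumberField L] [IsCMField L]
variable [MeasurableSpace (quasiSplit (↥(maximalRealSubfield L)) L (IsCMField.complexConj L) 2).Adelic] [BorelSpace (quasiSplit (↥(maximalRealSubfield L)) L (IsCMField.complexConj L) 2).Adelic]
/-! ## §1 On the tube: `⟪φ̂, [Λ^T E(φ₁H^z)]⟫ = 0` for every cusp form `φ` and every level-`K′` section `φ₁` -/

section Tube

variable (μ : Measure (quasiSplit (↥(maximalRealSubfield L)) L (IsCMField.complexConj L) 2).automorphicQuotient) [(quasiSplit (↥(maximalRealSubfield L)) L (IsCMField.complexConj L) 2).IsAutomorphicMeasure μ]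

/-- **`⟪φ̂, v⟫ = 0` ON THE TUBE, LEVEL `K′`**: `1 < Re z`, `T ≥ 1`, `ν` Haar on `N(𝔸)` with a fundamental domain `𝓕` of compact closure, `𝔓.radical i = N(𝔸)`, `φ₁` a CONTINUOUS
BOUNDED left-`N(𝔸)`∕`B(L⁺)`-invariant section (e.g. in `chiSectionSpace 1 K′ ω`), `φ ∈ cuspForms μ 𝔓`, `v =ᵐ Λ^T E(φ₁H^z)` in `L²(μ)` — under the SPHERICAL (Tr) letter
`Λ^T E((M:ℂ)H^{Re z}) ∈ L²(μ)` and the TAIL LETTER `‖E_B(E(φ₁H^z))(g) − φ₁(g)H(g)^z‖ ≤ C` on `{T < H}`: the split ★ `truncation_eisensteinSeriesU_eq_two` with `Mf := E_B(E f_z) − f_z`, ★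
FILE A twice against `Λ = invQuot φ` (`Λ_B ≡ 0`), `hL1` by ★ FILE B + Hölder. [cite: MoeglinWaldspurger1995, II.1.7–II.1.8, IV.1.11] [cite: BernsteinLapid2019, §4 Claim 2] -/
theorem inner_cuspFormsToLp_eq_zero_of_ae_eq_truncation_level_cm_two
    (ν : Measure ↥(adelicUnipotent (↥(maximalRealSubfield L)) L (IsCMField.complexConj L) 2)) [ν.IsHaarMeasure]
    {𝓕 : Set ↥(adelicUnipotent (↥(maximalRealSubfield L)) L (IsCMField.complexConj L) 2)}
    (h𝓕N : IsFundamentalDomain ↥(rationalUnipotent (↥(maximalRealSubfield L)) L (IsCMField.complexConj L) 2) 𝓕 ν) (h𝓕c : IsCompact (closure 𝓕))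
    (𝔓 : (quasiSplit (↥(maximalRealSubfield L)) L (IsCMField.complexConj L) 2).ParabolicUnipotentData) (i : 𝔓.ι)
    (h𝔓 : 𝔓.radical i = adelicUnipotent (↥(maximalRealSubfield L)) L (IsCMField.complexConj L) 2)
    {φ₁ : (quasiSplit (↥(maximalRealSubfield L)) L (IsCMField.complexConj L) 2).Adelic → ℂ} (hφc : Continuous φ₁) {M : ℝ} (hφM : ∀ x, ‖φ₁ x‖ ≤ M)
    (hφN : ∀ (u : ↥(adelicUnipotent (↥(maximalRealSubfield L)) L (IsCMField.complexConj L) 2)) (x : (quasiSplit (↥(maximalRealSubfield L)) L (IsCMField.complexConj L) 2).Adelic),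
      φ₁ ((u : (quasiSplit (↥(maximalRealSubfield L)) L (IsCMField.complexConj L) 2).Adelic) * x) = φ₁ x)
    (hφB : ∀ b ∈ borelU ((IsCMField.complexConj L : L ≃ₐ[↥(maximalRealSubfield L)] L) : L →+* L) ((StdForm.antidiagonal 2).over L),
      ∀ x : (quasiSplit (↥(maximalRealSubfield L)) L (IsCMField.complexConj L) 2).Adelic,
        φ₁ ((quasiSplit (↥(maximalRealSubfield L)) L (IsCMField.complexConj L) 2).toAdelic b * x) = φ₁ x)
    {T : ℝ≥0} (hT : 1 ≤ T) {z : ℂ} (hz : 1 < z.re)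
    {C : ℝ} (hMbd : ∀ g : (quasiSplit (↥(maximalRealSubfield L)) L (IsCMField.complexConj L) 2).Adelic, T < borelHeight g →
      ‖borelConstantTerm ν 𝓕 (eisensteinSeriesU (flatSectionU φ₁ z)) g - flatSectionU φ₁ z g‖ ≤ C)
    (v : (quasiSplit (↥(maximalRealSubfield L)) L (IsCMField.complexConj L) 2).L2 μ)
    (hv : (v : (quasiSplit (↥(maximalRealSubfield L)) L (IsCMField.complexConj L) 2).automorphicQuotient → ℂ) =ᵐ[μ]
      (quasiSplit (↥(maximalRealSubfield L)) L (IsCMField.complexConj L) 2).quotFun (truncation ν 𝓕 T (eisensteinSeriesU (flatSectionU φ₁ z))))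
    (hL2 : MemLp ((quasiSplit (↥(maximalRealSubfield L)) L (IsCMField.complexConj L) 2).quotFun
      (truncation ν 𝓕 T (eisensteinSeriesU (flatSectionU (fun _ : (quasiSplit (↥(maximalRealSubfield L)) L (IsCMField.complexConj L) 2).Adelic => ((M : ℝ) : ℂ)) ((z.re : ℝ) : ℂ))))) 2 μ)
    (φ : ↥((quasiSplit (↥(maximalRealSubfield L)) L (IsCMField.complexConj L) 2).cuspForms μ 𝔓)) :
    ⟪(quasiSplit (↥(maximalRealSubfield L)) L (IsCMField.complexConj L) 2).cuspFormsToLp μ 𝔓 φ, v⟫_ℂ = 0 := by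
  haveI := t2Space_adeleRing_of_numberField L
  haveI := locallyCompactSpace_adeleRing' L
  haveI := secondCountableTopology_adeleRing L
  haveI : T2Space (quasiSplit (↥(maximalRealSubfield L)) L (IsCMField.complexConj L) 2).Adelic :=
    inferInstanceAs (T2Space (adelic (↥(maximalRealSubfield L)) L (IsCMField.complexConj L) 2 ((StdForm.antidiagonal 2).over L)))
  haveI : LocallyCompactSpace (quasiSplit (↥(maximalRealSubfield L)) L (IsCMField.complexConj L) 2).Adelic :=
    inferInstanceAs (LocallyCompactSpace (adelic (↥(maximalRealSubfield L)) L (IsCMField.complexConj L) 2 ((StdForm.antidiagonal 2).over L)))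
  haveI : SecondCountableTopology (quasiSplit (↥(maximalRealSubfield L)) L (IsCMField.complexConj L) 2).Adelic :=
    inferInstanceAs (SecondCountableTopology (adelic (↥(maximalRealSubfield L)) L (IsCMField.complexConj L) 2 ((StdForm.antidiagonal 2).over L)))
  have hc : (IsCMField.complexConj L) * (IsCMField.complexConj L) = 1 := AlgEquiv.ext fun x => IsCMField.complexConj_apply_apply L x
  have hc1 : (IsCMField.complexConj L) ≠ 1 := IsCMField.complexConj_ne_one L
  haveI : (haar : Measure (quasiSplit (↥(maximalRealSubfield L)) L (IsCMField.complexConj L) 2).Adelic).IsMulRightInvariant :=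
    forall_isHaarMeasure_isMulRightInvariant_quasiSplit_cm L (le_refl 2) haar inferInstance
  haveI : (haar : Measure (quasiSplit (↥(maximalRealSubfield L)) L (IsCMField.complexConj L) 2).Adelic).IsInvInvariant := isInvInvariant_of_isMulRightInvariant _
  haveI : ν.IsInvInvariant := isInvInvariant_of_isHaarMeasure_two ν
  have h𝓕₀ : ν 𝓕 ≠ 0 := measure_ne_zero_of_isFundamentalDomain_rationalUnipotent ν h𝓕N
  haveI : ν.IsMulRightInvariant := by
    have h := Measure.inv.instIsMulRightInvariant (μ := ν)
    rwa [Measure.inv_eq_self] at h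
  have h𝓕top : ν 𝓕 ≠ ∞ := ((measure_mono subset_closure).trans_lt h𝓕c.measure_lt_top).ne
  obtain ⟨β, hβ⟩ := exists_isCoveringWeight_arithmeticBorel (F := (↥(maximalRealSubfield L))) (E := L) (c := (IsCMField.complexConj L)) (N := 2)

  set f : (quasiSplit (↥(maximalRealSubfield L)) L (IsCMField.complexConj L) 2).Adelic → ℂ := flatSectionU φ₁ z with hf
  set Mf : (quasiSplit (↥(maximalRealSubfield L)) L (IsCMField.complexConj L) 2).Adelic → ℂ := fun g => borelConstantTerm ν 𝓕 (eisensteinSeriesU f) g - f g with hMf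
  set f₁ : (quasiSplit (↥(maximalRealSubfield L)) L (IsCMField.complexConj L) 2).Adelic → ℂ :=
    {g : (quasiSplit (↥(maximalRealSubfield L)) L (IsCMField.complexConj L) 2).Adelic | borelHeight g ≤ T}.indicator f with hf₁
  set f₂ : (quasiSplit (↥(maximalRealSubfield L)) L (IsCMField.complexConj L) 2).Adelic → ℂ :=
    {g : (quasiSplit (↥(maximalRealSubfield L)) L (IsCMField.complexConj L) 2).Adelic | T < borelHeight g}.indicator Mf with hf₂
  have hφB' : ∀ b ∈ arithmeticBorel (↥(maximalRealSubfield L)) L (IsCMField.complexConj L) 2, ∀ x : (quasiSplit (↥(maximalRealSubfield L)) L (IsCMField.complexConj L) 2).Adelic,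
      φ₁ ((b : (quasiSplit (↥(maximalRealSubfield L)) L (IsCMField.complexConj L) 2).Adelic) * x) = φ₁ x := forall_arithmeticBorel_iff.2 hφB
  have hfB : ∀ b ∈ arithmeticBorel (↥(maximalRealSubfield L)) L (IsCMField.complexConj L) 2, ∀ x : (quasiSplit (↥(maximalRealSubfield L)) L (IsCMField.complexConj L) 2).Adelic,
      f ((b : (quasiSplit (↥(maximalRealSubfield L)) L (IsCMField.complexConj L) 2).Adelic) * x) = f x := fun b hb x => by
    simp only [hf, flatSectionU_apply, K2E1TruncatedEisensteinExplicit.borelHeight_arithmeticBorel_mul hb, hφB' b hb x]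
  have hEG : ∀ (γ : (quasiSplit (↥(maximalRealSubfield L)) L (IsCMField.complexConj L) 2).arithmeticSubgroup) (x : (quasiSplit (↥(maximalRealSubfield L)) L (IsCMField.complexConj L) 2).Adelic),
      eisensteinSeriesU f ((γ : (quasiSplit (↥(maximalRealSubfield L)) L (IsCMField.complexConj L) 2).Adelic) * x) = eisensteinSeriesU f x := fun γ x => eisensteinSeriesU_flatSectionU_arithmeticSubgroup_mul hφB z γ x
  have hCTB : ∀ b ∈ arithmeticBorel (↥(maximalRealSubfield L)) L (IsCMField.complexConj L) 2, ∀ x : (quasiSplit (↥(maximalRealSubfield L)) L (IsCMField.complexConj L) 2).Adelic,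
      borelConstantTerm ν 𝓕 (eisensteinSeriesU f) ((b : (quasiSplit (↥(maximalRealSubfield L)) L (IsCMField.complexConj L) 2).Adelic) * x) = borelConstantTerm ν 𝓕 (eisensteinSeriesU f) x := fun b hb x =>
    borelConstantTerm_rational_borel_mul_of_rational_invariant ν h𝓕N hEG b hb x
  have hEN : ∀ u : ↥(adelicUnipotent (↥(maximalRealSubfield L)) L (IsCMField.complexConj L) 2), u ∈ rationalUnipotent (↥(maximalRealSubfield L)) L (IsCMField.complexConj L) 2 →
      ∀ x : (quasiSplit (↥(maximalRealSubfield L)) L (IsCMField.complexConj L) 2).Adelic, eisensteinSeriesU f ((u : (quasiSplit (↥(maximalRealSubfield L)) L (IsCMField.complexConj L) 2).Adelic) * x) = eisensteinSeriesU f x := fun u hu x => by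
    obtain ⟨γ, hγ⟩ := (mem_rationalUnipotent_iff u).1 hu
    rw [← hγ]
    exact eisensteinSeriesU_flatSectionU_rational_mul hφB z γ x
  have hCTN : ∀ (u : ↥(adelicUnipotent (↥(maximalRealSubfield L)) L (IsCMField.complexConj L) 2)) (g : (quasiSplit (↥(maximalRealSubfield L)) L (IsCMField.complexConj L) 2).Adelic),
      borelConstantTerm ν 𝓕 (eisensteinSeriesU f) ((u : (quasiSplit (↥(maximalRealSubfield L)) L (IsCMField.complexConj L) 2).Adelic) * g) = borelConstantTerm ν 𝓕 (eisensteinSeriesU f) g := fun u g =>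
    borelConstantTerm_unipotent_mul_of_isMulRightInvariant ν h𝓕N hEN u g
  have hfN : ∀ (u : ↥(adelicUnipotent (↥(maximalRealSubfield L)) L (IsCMField.complexConj L) 2)) (g : (quasiSplit (↥(maximalRealSubfield L)) L (IsCMField.complexConj L) 2).Adelic), f ((u : (quasiSplit (↥(maximalRealSubfield L)) L (IsCMField.complexConj L) 2).Adelic) * g) = f g := fun u g => by
    simp only [hf, flatSectionU_apply, hφN u g, borelHeight_unipotent_mul u.2]
  have hMfB : ∀ b ∈ arithmeticBorel (↥(maximalRealSubfield L)) L (IsCMField.complexConj L) 2, ∀ x : (quasiSplit (↥(maximalRealSubfield L)) L (IsCMField.complexConj L) 2).Adelic,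
      Mf ((b : (quasiSplit (↥(maximalRealSubfield L)) L (IsCMField.complexConj L) 2).Adelic) * x) = Mf x := fun b hb x => by
    show borelConstantTerm ν 𝓕 (eisensteinSeriesU f) ((b : (quasiSplit (↥(maximalRealSubfield L)) L (IsCMField.complexConj L) 2).Adelic) * x) - f ((b : (quasiSplit (↥(maximalRealSubfield L)) L (IsCMField.complexConj L) 2).Adelic) * x) = borelConstantTerm ν 𝓕 (eisensteinSeriesU f) x - f x
    rw [hCTB b hb x, hfB b hb x]
  have hMfN : ∀ (u : ↥(adelicUnipotent (↥(maximalRealSubfield L)) L (IsCMField.complexConj L) 2)) (g : (quasiSplit (↥(maximalRealSubfield L)) L (IsCMField.complexConj L) 2).Adelic), Mf ((u : (quasiSplit (↥(maximalRealSubfield L)) L (IsCMField.complexConj L) 2).Adelic) * g) = Mf g := fun u g => by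
    show borelConstantTerm ν 𝓕 (eisensteinSeriesU f) ((u : (quasiSplit (↥(maximalRealSubfield L)) L (IsCMField.complexConj L) 2).Adelic) * g) - f ((u : (quasiSplit (↥(maximalRealSubfield L)) L (IsCMField.complexConj L) 2).Adelic) * g) = borelConstantTerm ν 𝓕 (eisensteinSeriesU f) g - f g
    rw [hCTN u g, hfN u g]
  have hf₁B := forall_arithmeticBorel_indicator hfB fun h => h ≤ T
  have hf₂B := forall_arithmeticBorel_indicator hMfB fun h => T < h
  have hCT : ∀ x : (quasiSplit (↥(maximalRealSubfield L)) L (IsCMField.complexConj L) 2).Adelic, T < borelHeight x →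
      borelConstantTerm ν 𝓕 (eisensteinSeriesU f) x = f x + Mf x := fun x _ => (add_sub_cancel (f x) _).symm
  have hfm : Measurable f := measurable_flatSectionU hφc.measurable _
  have hEm : Measurable (eisensteinSeriesU f) := (continuous_eisensteinSeriesU_flatSectionU_cm_two L hz hφc hφM).measurable
  haveI : SecondCountableTopology ↥(adelicUnipotent (↥(maximalRealSubfield L)) L (IsCMField.complexConj L) 2) := TopologicalSpace.Subtype.secondCountableTopology _
  have hNcl : IsClosed ((adelicUnipotent (↥(maximalRealSubfield L)) L (IsCMField.complexConj L) 2 :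
      Set (quasiSplit (↥(maximalRealSubfield L)) L (IsCMField.complexConj L) 2).Adelic)) := by
    change IsClosed (⇑(adelicVal (↥(maximalRealSubfield L)) L (IsCMField.complexConj L) 2 ((StdForm.antidiagonal 2).over L)) ⁻¹'
      ((upperUnitriangular (Fin 2) (AdeleRing (𝓞 L) L) : Subgroup (GL (Fin 2) (AdeleRing (𝓞 L) L))) : Set (GL (Fin 2) (AdeleRing (𝓞 L) L))))
    exact (isClosed_upperUnitriangular (R := AdeleRing (𝓞 L) L)).preimage continuous_subtype_val
  haveI : LocallyCompactSpace ↥(adelicUnipotent (↥(maximalRealSubfield L)) L (IsCMField.complexConj L) 2) := hNcl.locallyCompactSpace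
  have hMfm : Measurable Mf := (measurable_borelConstantTerm ν 𝓕 hEm).sub hfm
  have hsle : MeasurableSet {g : (quasiSplit (↥(maximalRealSubfield L)) L (IsCMField.complexConj L) 2).Adelic | borelHeight g ≤ T} :=
    measurableSet_le continuous_borelHeight.measurable measurable_const
  have hslt : MeasurableSet {g : (quasiSplit (↥(maximalRealSubfield L)) L (IsCMField.complexConj L) 2).Adelic | T < borelHeight g} :=
    measurableSet_lt measurable_const continuous_borelHeight.measurable
  have hf₁m : Measurable f₁ := hfm.indicator hsle
  have hf₂m : Measurable f₂ := hMfm.indicator hslt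
  have hf₁N : ∀ (u : ↥(adelicUnipotent (↥(maximalRealSubfield L)) L (IsCMField.complexConj L) 2)) (g : (quasiSplit (↥(maximalRealSubfield L)) L (IsCMField.complexConj L) 2).Adelic),
      f₁ ((u : (quasiSplit (↥(maximalRealSubfield L)) L (IsCMField.complexConj L) 2).Adelic) * g) = f₁ g := fun u g => by
    simp only [hf₁, Set.indicator_apply, Set.mem_setOf_eq, borelHeight_unipotent_mul u.2, hfN u g]
  have hf₂N : ∀ (u : ↥(adelicUnipotent (↥(maximalRealSubfield L)) L (IsCMField.complexConj L) 2)) (g : (quasiSplit (↥(maximalRealSubfield L)) L (IsCMField.complexConj L) 2).Adelic),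
      f₂ ((u : (quasiSplit (↥(maximalRealSubfield L)) L (IsCMField.complexConj L) 2).Adelic) * g) = f₂ g := fun u g => by
    simp only [hf₂, Set.indicator_apply, Set.mem_setOf_eq, borelHeight_unipotent_mul u.2, hMfN u g]
  obtain ⟨hΛm, hΛinv, hΛq, hΛB⟩ := invQuot_package_of_mem_cuspForms 𝔓 i h𝔓 ν h𝓕N φ.2
  have hΛG : ∀ (γ : (quasiSplit (↥(maximalRealSubfield L)) L (IsCMField.complexConj L) 2).arithmeticSubgroup) (x : (quasiSplit (↥(maximalRealSubfield L)) L (IsCMField.complexConj L) 2).Adelic),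
      invQuot (quasiSplit (↥(maximalRealSubfield L)) L (IsCMField.complexConj L) 2) (φ : (quasiSplit (↥(maximalRealSubfield L)) L (IsCMField.complexConj L) 2).automorphicQuotient → ℂ)
        ((γ : (quasiSplit (↥(maximalRealSubfield L)) L (IsCMField.complexConj L) 2).Adelic) * x) =
      invQuot (quasiSplit (↥(maximalRealSubfield L)) L (IsCMField.complexConj L) 2) (φ : (quasiSplit (↥(maximalRealSubfield L)) L (IsCMField.complexConj L) 2).automorphicQuotient → ℂ) x :=
    fun γ x => hΛinv _ ((quasiSplit (↥(maximalRealSubfield L)) L (IsCMField.complexConj L) 2).arithmeticSubgroup_le_quotientSubgroup γ.2) x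
  have hq : ∀ x : (quasiSplit (↥(maximalRealSubfield L)) L (IsCMField.complexConj L) 2).automorphicQuotient,
      invQuot (quasiSplit (↥(maximalRealSubfield L)) L (IsCMField.complexConj L) 2) (φ : (quasiSplit (↥(maximalRealSubfield L)) L (IsCMField.complexConj L) 2).automorphicQuotient → ℂ)
        (Quotient.out (x : (quasiSplit (↥(maximalRealSubfield L)) L (IsCMField.complexConj L) 2).Adelic ⧸ (quasiSplit (↥(maximalRealSubfield L)) L (IsCMField.complexConj L) 2).quotientSubgroup))⁻¹ =
      (φ : (quasiSplit (↥(maximalRealSubfield L)) L (IsCMField.complexConj L) 2).automorphicQuotient → ℂ) x := fun x => congrFun hΛq x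
  have hφ2 : MemLp (φ : (quasiSplit (↥(maximalRealSubfield L)) L (IsCMField.complexConj L) 2).automorphicQuotient → ℂ) 2 μ := AdelicGroupData.memLp_of_mem_cuspForms φ.2
  have hφ1 : Integrable (φ : (quasiSplit (↥(maximalRealSubfield L)) L (IsCMField.complexConj L) 2).automorphicQuotient → ℂ) μ := hφ2.integrable one_le_two
  have hφ2' : ∫⁻ x, ‖(φ : (quasiSplit (↥(maximalRealSubfield L)) L (IsCMField.complexConj L) 2).automorphicQuotient → ℂ) x‖ₑ ^ (2 : ℝ) ∂μ < ∞ := by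
    have h := lintegral_rpow_enorm_lt_top_of_eLpNorm_lt_top (p := (2 : ℝ≥0∞)) (by norm_num) (by norm_num) hφ2.2
    simpa only [ENNReal.toReal_ofNat] using h
  -- the `L¹` letter for `f₂` (one coset above the floor): THE TAIL LETTER `hMbd`
  have hMfbd : ∀ g : (quasiSplit (↥(maximalRealSubfield L)) L (IsCMField.complexConj L) 2).Adelic, T < borelHeight g → ‖Mf g‖ ≤ max C 0 := fun g hg =>
    (hMbd g hg).trans (le_max_left _ _)
  have hL1₂ : ∫⁻ g, β g * ‖f₂ g * conj (invQuot (quasiSplit (↥(maximalRealSubfield L)) L (IsCMField.complexConj L) 2)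
      (φ : (quasiSplit (↥(maximalRealSubfield L)) L (IsCMField.complexConj L) 2).automorphicQuotient → ℂ) g)‖ₑ ∂haar < ∞ := by
    refine lintegral_weight_enorm_mul_lt_top_of_lintegral_quotient_lt_top μ haar hβ hf₂m hΛm hf₂B hΛG ?_
    calc ∫⁻ x : (quasiSplit (↥(maximalRealSubfield L)) L (IsCMField.complexConj L) 2).automorphicQuotient,
          (∑' q : Quotient (QuotientGroup.rightRel (arithmeticBorel (↥(maximalRealSubfield L)) L (IsCMField.complexConj L) 2)),
            ‖f₂ (((q.out : (quasiSplit (↥(maximalRealSubfield L)) L (IsCMField.complexConj L) 2).arithmeticSubgroup) : (quasiSplit (↥(maximalRealSubfield L)) L (IsCMField.complexConj L) 2).Adelic) *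
              (Quotient.out x : (quasiSplit (↥(maximalRealSubfield L)) L (IsCMField.complexConj L) 2).Adelic)⁻¹)‖ₑ) *
            ‖invQuot (quasiSplit (↥(maximalRealSubfield L)) L (IsCMField.complexConj L) 2) (φ : (quasiSplit (↥(maximalRealSubfield L)) L (IsCMField.complexConj L) 2).automorphicQuotient → ℂ)
              (Quotient.out x : (quasiSplit (↥(maximalRealSubfield L)) L (IsCMField.complexConj L) 2).Adelic)⁻¹‖ₑ ∂μ
        ≤ ∫⁻ x, ENNReal.ofReal (max C 0) * ‖(φ : (quasiSplit (↥(maximalRealSubfield L)) L (IsCMField.complexConj L) 2).automorphicQuotient → ℂ) x‖ₑ ∂μ :=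
          lintegral_mono fun x => by
            rw [hq x]
            exact mul_le_mul' (tsum_enorm_indicator_lt_le siegel_two hT (le_max_right _ _) hMfbd _) le_rfl
      _ < ∞ := by
          rw [lintegral_const_mul' _ _ ENNReal.ofReal_ne_top]
          exact ENNReal.mul_lt_top ENNReal.ofReal_lt_top hφ1.2
  -- the `L¹` letter for `f₁` (majorant through the real point, Hölder)
  obtain ⟨C₁, hC₁, hmaj⟩ := exists_tsum_enorm_lowIndicator_le_cm_two L ν h𝓕N h𝓕c ((M : ℝ) : ℂ) hT hz
  have hdom : ∀ x : (quasiSplit (↥(maximalRealSubfield L)) L (IsCMField.complexConj L) 2).Adelic, ‖f₁ x‖ₑ ≤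
      ‖({g : (quasiSplit (↥(maximalRealSubfield L)) L (IsCMField.complexConj L) 2).Adelic | borelHeight g ≤ T}.indicator (flatSectionU (fun _ : (quasiSplit (↥(maximalRealSubfield L)) L (IsCMField.complexConj L) 2).Adelic => ((M : ℝ) : ℂ)) z)) x‖ₑ := fun x => by
    by_cases hx : x ∈ {g : (quasiSplit (↥(maximalRealSubfield L)) L (IsCMField.complexConj L) 2).Adelic | borelHeight g ≤ T}
    · rw [hf₁, Set.indicator_of_mem hx, Set.indicator_of_mem hx, hf, flatSectionU_apply, flatSectionU_apply, ← ofReal_norm, ← ofReal_norm, norm_mul, norm_mul]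
      refine ENNReal.ofReal_le_ofReal (mul_le_mul_of_nonneg_right ?_ (norm_nonneg _))
      calc ‖φ₁ x‖ ≤ M := hφM x
        _ ≤ |M| := le_abs_self M
        _ = ‖((M : ℝ) : ℂ)‖ := by rw [Complex.norm_real, Real.norm_eq_abs]
    · rw [hf₁, Set.indicator_of_notMem hx, Set.indicator_of_notMem hx]
  have hL1₁ : ∫⁻ g, β g * ‖f₁ g * conj (invQuot (quasiSplit (↥(maximalRealSubfield L)) L (IsCMField.complexConj L) 2)
      (φ : (quasiSplit (↥(maximalRealSubfield L)) L (IsCMField.complexConj L) 2).automorphicQuotient → ℂ) g)‖ₑ ∂haar < ∞ := by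
    refine lintegral_weight_enorm_mul_lt_top_of_lintegral_quotient_lt_top μ haar hβ hf₁m hΛm hf₁B hΛG ?_
    have hum : AEMeasurable (fun x => ‖(quasiSplit (↥(maximalRealSubfield L)) L (IsCMField.complexConj L) 2).quotFun
        (truncation ν 𝓕 T (eisensteinSeriesU (flatSectionU (fun _ : (quasiSplit (↥(maximalRealSubfield L)) L (IsCMField.complexConj L) 2).Adelic => ((M : ℝ) : ℂ)) ((z.re : ℝ) : ℂ)))) x‖ₑ) μ :=
      hL2.1.aemeasurable.enorm
    have hφm : AEMeasurable (fun x => ‖(φ : (quasiSplit (↥(maximalRealSubfield L)) L (IsCMField.complexConj L) 2).automorphicQuotient → ℂ) x‖ₑ) μ := hφ2.1.aemeasurable.enorm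
    have hH := ENNReal.lintegral_mul_le_Lp_mul_Lq μ Real.HolderConjugate.two_two hum hφm
    have hfinH : ∫⁻ x, ‖(quasiSplit (↥(maximalRealSubfield L)) L (IsCMField.complexConj L) 2).quotFun
        (truncation ν 𝓕 T (eisensteinSeriesU (flatSectionU (fun _ : (quasiSplit (↥(maximalRealSubfield L)) L (IsCMField.complexConj L) 2).Adelic => ((M : ℝ) : ℂ)) ((z.re : ℝ) : ℂ)))) x‖ₑ *
        ‖(φ : (quasiSplit (↥(maximalRealSubfield L)) L (IsCMField.complexConj L) 2).automorphicQuotient → ℂ) x‖ₑ ∂μ < ∞ := by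
      refine lt_of_le_of_lt hH (ENNReal.mul_lt_top ?_ ?_)
      · refine ENNReal.rpow_lt_top_of_nonneg (by norm_num) (lt_top_iff_ne_top.1 ?_)
        have h := lintegral_rpow_enorm_lt_top_of_eLpNorm_lt_top (p := (2 : ℝ≥0∞)) (by norm_num) (by norm_num) hL2.2
        simpa only [ENNReal.toReal_ofNat] using h
      · exact ENNReal.rpow_lt_top_of_nonneg (by norm_num) (lt_top_iff_ne_top.1 hφ2')
    calc ∫⁻ x : (quasiSplit (↥(maximalRealSubfield L)) L (IsCMField.complexConj L) 2).automorphicQuotient,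
          (∑' q : Quotient (QuotientGroup.rightRel (arithmeticBorel (↥(maximalRealSubfield L)) L (IsCMField.complexConj L) 2)),
            ‖f₁ (((q.out : (quasiSplit (↥(maximalRealSubfield L)) L (IsCMField.complexConj L) 2).arithmeticSubgroup) : (quasiSplit (↥(maximalRealSubfield L)) L (IsCMField.complexConj L) 2).Adelic) *
              (Quotient.out x : (quasiSplit (↥(maximalRealSubfield L)) L (IsCMField.complexConj L) 2).Adelic)⁻¹)‖ₑ) *
            ‖invQuot (quasiSplit (↥(maximalRealSubfield L)) L (IsCMField.complexConj L) 2) (φ : (quasiSplit (↥(maximalRealSubfield L)) L (IsCMField.complexConj L) 2).automorphicQuotient → ℂ)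
              (Quotient.out x : (quasiSplit (↥(maximalRealSubfield L)) L (IsCMField.complexConj L) 2).Adelic)⁻¹‖ₑ ∂μ
        ≤ ∫⁻ x, (‖(quasiSplit (↥(maximalRealSubfield L)) L (IsCMField.complexConj L) 2).quotFun
              (truncation ν 𝓕 T (eisensteinSeriesU (flatSectionU (fun _ : (quasiSplit (↥(maximalRealSubfield L)) L (IsCMField.complexConj L) 2).Adelic => ((M : ℝ) : ℂ)) ((z.re : ℝ) : ℂ)))) x‖ₑ *
              ‖(φ : (quasiSplit (↥(maximalRealSubfield L)) L (IsCMField.complexConj L) 2).automorphicQuotient → ℂ) x‖ₑ +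
            C₁ * ‖(φ : (quasiSplit (↥(maximalRealSubfield L)) L (IsCMField.complexConj L) 2).automorphicQuotient → ℂ) x‖ₑ) ∂μ :=
          lintegral_mono fun x => by
            rw [hq x, ← add_mul]
            exact mul_le_mul' ((ENNReal.tsum_le_tsum fun q => hdom _).trans (hmaj _)) le_rfl
      _ < ∞ := by
          have hm2 : AEMeasurable (fun x => ‖(quasiSplit (↥(maximalRealSubfield L)) L (IsCMField.complexConj L) 2).quotFun
              (truncation ν 𝓕 T (eisensteinSeriesU (flatSectionU (fun _ : (quasiSplit (↥(maximalRealSubfield L)) L (IsCMField.complexConj L) 2).Adelic => ((M : ℝ) : ℂ)) ((z.re : ℝ) : ℂ)))) x‖ₑ *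
              ‖(φ : (quasiSplit (↥(maximalRealSubfield L)) L (IsCMField.complexConj L) 2).automorphicQuotient → ℂ) x‖ₑ) μ := hum.mul hφm
          rw [lintegral_add_left' hm2, lintegral_const_mul' _ _ hC₁.ne]
          exact ENNReal.add_lt_top.2 ⟨hfinH, ENNReal.mul_lt_top hC₁ hφ1.2⟩
  obtain ⟨-, -, hint₁, -⟩ := integrable_and_integral_quotFun_eisensteinSeriesU_mul_conj_eq_two hc hc1 μ haar ν h𝓕N h𝓕₀ h𝓕top hβ hf₁m hΛm hf₁N hf₁B hΛG hL1₁
  obtain ⟨-, -, hint₂, -⟩ := integrable_and_integral_quotFun_eisensteinSeriesU_mul_conj_eq_two hc hc1 μ haar ν h𝓕N h𝓕₀ h𝓕top hβ hf₂m hΛm hf₂N hf₂B hΛG hL1₂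
  have h0₁ := integral_quotFun_eisensteinSeriesU_mul_conj_eq_zero_two hc hc1 μ haar ν h𝓕N h𝓕₀ h𝓕top hβ hf₁m hΛm hf₁N hf₁B hΛG hL1₁ (ae_of_all _ hΛB)
  have h0₂ := integral_quotFun_eisensteinSeriesU_mul_conj_eq_zero_two hc hc1 μ haar ν h𝓕N h𝓕₀ h𝓕top hβ hf₂m hΛm hf₂N hf₂B hΛG hL1₂ (ae_of_all _ hΛB)
  rw [hΛq] at hint₁ hint₂ h0₁ h0₂
  have hsum : ∀ y : (quasiSplit (↥(maximalRealSubfield L)) L (IsCMField.complexConj L) 2).Adelic,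
      Summable fun q : Quotient (orbitRel ↥(borelU ((IsCMField.complexConj L : L ≃ₐ[↥(maximalRealSubfield L)] L) : L →+* L) ((StdForm.antidiagonal 2).over L))
        ↥(unitaryGroupOfForm ((IsCMField.complexConj L : L ≃ₐ[↥(maximalRealSubfield L)] L) : L →+* L) ((StdForm.antidiagonal 2).over L))) =>
        f ((quasiSplit (↥(maximalRealSubfield L)) L (IsCMField.complexConj L) 2).toAdelic (q.out : ↥(unitaryGroupOfForm ((IsCMField.complexConj L : L ≃ₐ[↥(maximalRealSubfield L)] L) : L →+* L) ((StdForm.antidiagonal 2).over L))) * y) :=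
    fun y => (summable_eisensteinSeriesU_flatSectionU_cm_two L hz (φ := φ₁) (M := M) hφM y).of_norm
  have hsplit : ∀ x : (quasiSplit (↥(maximalRealSubfield L)) L (IsCMField.complexConj L) 2).automorphicQuotient,
      (quasiSplit (↥(maximalRealSubfield L)) L (IsCMField.complexConj L) 2).quotFun (truncation ν 𝓕 T (eisensteinSeriesU f)) x =
        (quasiSplit (↥(maximalRealSubfield L)) L (IsCMField.complexConj L) 2).quotFun (eisensteinSeriesU f₁) x -
          (quasiSplit (↥(maximalRealSubfield L)) L (IsCMField.complexConj L) 2).quotFun (eisensteinSeriesU f₂) x := fun x =>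
    truncation_eisensteinSeriesU_eq_two (ν := ν) (𝓕 := 𝓕) hT hfB hMfB hCT (hsum _)
  rw [AdelicGroupData.cuspFormsToLp_apply, MeasureTheory.L2.inner_def]
  have hae : (fun x : (quasiSplit (↥(maximalRealSubfield L)) L (IsCMField.complexConj L) 2).automorphicQuotient =>
      ⟪(hφ2.toLp (φ : (quasiSplit (↥(maximalRealSubfield L)) L (IsCMField.complexConj L) 2).automorphicQuotient → ℂ)) x, v x⟫_ℂ) =ᵐ[μ]
      fun x => (quasiSplit (↥(maximalRealSubfield L)) L (IsCMField.complexConj L) 2).quotFun (eisensteinSeriesU f₁) x *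
          conj ((φ : (quasiSplit (↥(maximalRealSubfield L)) L (IsCMField.complexConj L) 2).automorphicQuotient → ℂ) x) -
        (quasiSplit (↥(maximalRealSubfield L)) L (IsCMField.complexConj L) 2).quotFun (eisensteinSeriesU f₂) x *
          conj ((φ : (quasiSplit (↥(maximalRealSubfield L)) L (IsCMField.complexConj L) 2).automorphicQuotient → ℂ) x) := by
    filter_upwards [hφ2.coeFn_toLp, hv] with x hx hvx
    rw [hx, hvx, RCLike.inner_apply, hsplit x]
    ring
  rw [integral_congr_ae hae, integral_sub hint₁ hint₂, h0₁, h0₂, sub_zero]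

end Tube

/-! ## §2 The head: the letter (L-ORTH) for a level-`K′` section -/

section Head

variable (μ : Measure (quasiSplit (↥(maximalRealSubfield L)) L (IsCMField.complexConj L) 2).automorphicQuotient) [(quasiSplit (↥(maximalRealSubfield L)) L (IsCMField.complexConj L) 2).IsAutomorphicMeasure μ]

/-- **(L-ORTH) AT LEVEL `K′` — THE LETTER `horth` FOR A LEVEL SECTION `φ₁`** (continuous, bounded by `M`, left-`N(𝔸)`∕`B(L⁺)`-invariant): with `Ec z = E(φ₁H^z)` on `D ∩ {1 < re}`,
the TAIL LETTER `hMbd` at every tube point of `D`, the SPHERICAL (Tr) letter `hTr` at every real `σ > 1`, the operator road's holomorphic `F z =ᵐ Λ^T(Ec z)` on `D`, its residue class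
`Res`, the Siegel indicator class `ind` and `κ : ℂ`: **`⟪Res + κ • ind, φ̂⟫ = 0` for every `φ ∈ cuspForms μ 𝔓`** — ★ 3b's proof verbatim (seed by §1 on a ball around `σ₀`, identity
principle ★ `inner_eq_zero_of_differentiableOn`, ★ `inner_cuspFormsToLp_eq_zero_of_ae_eq_siegelIndicator_cm_two`, limit). [cite: MoeglinWaldspurger1995, IV.1.11] [cite: BernsteinLapid2019, §4 Claim 2] -/
theorem horth_level_cm_two_of_letters
    (ν : Measure ↥(adelicUnipotent (↥(maximalRealSubfield L)) L (IsCMField.complexConj L) 2)) [ν.IsHaarMeasure]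
    {𝓕 : Set ↥(adelicUnipotent (↥(maximalRealSubfield L)) L (IsCMField.complexConj L) 2)}
    (h𝓕N : IsFundamentalDomain ↥(rationalUnipotent (↥(maximalRealSubfield L)) L (IsCMField.complexConj L) 2) 𝓕 ν) (h𝓕c : IsCompact (closure 𝓕))
    (𝔓 : (quasiSplit (↥(maximalRealSubfield L)) L (IsCMField.complexConj L) 2).ParabolicUnipotentData) (i : 𝔓.ι)
    (h𝔓 : 𝔓.radical i = adelicUnipotent (↥(maximalRealSubfield L)) L (IsCMField.complexConj L) 2)
    {φ₁ : (quasiSplit (↥(maximalRealSubfield L)) L (IsCMField.complexConj L) 2).Adelic → ℂ} (hφc : Continuous φ₁) {M : ℝ} (hφM : ∀ x, ‖φ₁ x‖ ≤ M)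
    (hφN : ∀ (u : ↥(adelicUnipotent (↥(maximalRealSubfield L)) L (IsCMField.complexConj L) 2)) (x : (quasiSplit (↥(maximalRealSubfield L)) L (IsCMField.complexConj L) 2).Adelic),
      φ₁ ((u : (quasiSplit (↥(maximalRealSubfield L)) L (IsCMField.complexConj L) 2).Adelic) * x) = φ₁ x)
    (hφB : ∀ b ∈ borelU ((IsCMField.complexConj L : L ≃ₐ[↥(maximalRealSubfield L)] L) : L →+* L) ((StdForm.antidiagonal 2).over L),
      ∀ x : (quasiSplit (↥(maximalRealSubfield L)) L (IsCMField.complexConj L) 2).Adelic,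
        φ₁ ((quasiSplit (↥(maximalRealSubfield L)) L (IsCMField.complexConj L) 2).toAdelic b * x) = φ₁ x)
    {T : ℝ≥0} (hT : 1 ≤ T)
    (Ec : ℂ → (quasiSplit (↥(maximalRealSubfield L)) L (IsCMField.complexConj L) 2).Adelic → ℂ) {D : Set ℂ} (hDo : IsOpen D) (hDc : IsPreconnected D)
    {σ₀ : ℝ} (hσ₀ : 1 < σ₀) (hσD : ∀ᶠ z in 𝓝 ((σ₀ : ℝ) : ℂ), z ∈ D) (hD1 : ∀ᶠ z in 𝓝[≠] (1 : ℂ), z ∈ D)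
    (hE2 : ∀ z ∈ D, 1 < z.re → Ec z = eisensteinSeriesU (flatSectionU φ₁ z))
    (hMbd : ∀ z ∈ D, 1 < z.re → ∃ C : ℝ, ∀ g : (quasiSplit (↥(maximalRealSubfield L)) L (IsCMField.complexConj L) 2).Adelic, T < borelHeight g →
      ‖borelConstantTerm ν 𝓕 (eisensteinSeriesU (flatSectionU φ₁ z)) g - flatSectionU φ₁ z g‖ ≤ C)
    (hTr : ∀ σ : ℝ, 1 < σ → MemLp ((quasiSplit (↥(maximalRealSubfield L)) L (IsCMField.complexConj L) 2).quotFun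
      (truncation ν 𝓕 T (eisensteinSeriesU (flatSectionU (fun _ : (quasiSplit (↥(maximalRealSubfield L)) L (IsCMField.complexConj L) 2).Adelic => ((M : ℝ) : ℂ)) ((σ : ℝ) : ℂ))))) 2 μ)
    (F : ℂ → (quasiSplit (↥(maximalRealSubfield L)) L (IsCMField.complexConj L) 2).L2 μ) (hFd : DifferentiableOn ℂ F D)
    (hFam : ∀ z ∈ D, ((F z : (quasiSplit (↥(maximalRealSubfield L)) L (IsCMField.complexConj L) 2).L2 μ) : (quasiSplit (↥(maximalRealSubfield L)) L (IsCMField.complexConj L) 2).automorphicQuotient → ℂ) =ᵐ[μ]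
      (quasiSplit (↥(maximalRealSubfield L)) L (IsCMField.complexConj L) 2).quotFun (truncation ν 𝓕 T (Ec z)))
    (Res : (quasiSplit (↥(maximalRealSubfield L)) L (IsCMField.complexConj L) 2).L2 μ) (hRes : Tendsto (fun z : ℂ => (z - 1) • F z) (𝓝[≠] 1) (𝓝 Res))
    (ind : (quasiSplit (↥(maximalRealSubfield L)) L (IsCMField.complexConj L) 2).L2 μ)
    (hind : ∀ hm : MemLp ((quasiSplit (↥(maximalRealSubfield L)) L (IsCMField.complexConj L) 2).quotFun fun t =>
      if T < supHeight (↥(maximalRealSubfield L)) L (IsCMField.complexConj L) 2 ((quasiSplit (↥(maximalRealSubfield L)) L (IsCMField.complexConj L) 2).toAutomorphicQuotient t⁻¹) then (1 : ℂ) else 0) 2 μ,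
      ind = hm.toLp _)
    (κ : ℂ) :
    ∀ φ : ↥((quasiSplit (↥(maximalRealSubfield L)) L (IsCMField.complexConj L) 2).cuspForms μ 𝔓),
      ⟪Res + κ • ind, (quasiSplit (↥(maximalRealSubfield L)) L (IsCMField.complexConj L) 2).cuspFormsToLp μ 𝔓 φ⟫_ℂ = 0 := by
  intro φ
  set w := (quasiSplit (↥(maximalRealSubfield L)) L (IsCMField.complexConj L) 2).cuspFormsToLp μ 𝔓 φ with hw
  obtain ⟨ε, hε, hball⟩ := Metric.eventually_nhds_iff_ball.1 hσD
  have hσ₀D : ((σ₀ : ℝ) : ℂ) ∈ D := hball _ (Metric.mem_ball_self hε)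
  have hseed : ∀ᶠ z in 𝓝 ((σ₀ : ℝ) : ℂ), ⟪w, F z⟫_ℂ = 0 := by
    have hmem : Metric.ball ((σ₀ : ℝ) : ℂ) (min ε (σ₀ - 1)) ∈ 𝓝 ((σ₀ : ℝ) : ℂ) := Metric.ball_mem_nhds _ (lt_min hε (by linarith))
    filter_upwards [hmem] with z hz
    rw [Metric.mem_ball] at hz
    have hzD : z ∈ D := hball _ (Metric.mem_ball.2 (hz.trans_le (min_le_left _ _)))
    have hzre : |z.re - σ₀| < σ₀ - 1 := by
      have h1 : |z.re - σ₀| ≤ dist z ((σ₀ : ℝ) : ℂ) := by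
        rw [Complex.dist_eq]
        have := Complex.abs_re_le_norm (z - ((σ₀ : ℝ) : ℂ))
        simpa only [Complex.sub_re, Complex.ofReal_re] using this
      exact h1.trans_lt (hz.trans_le (min_le_right _ _))
    have hz2 : 1 < z.re := by
      have := (abs_lt.1 hzre).1; linarith
    have hv := (hFam z hzD).trans (by rw [hE2 z hzD hz2])
    obtain ⟨C, hC⟩ := hMbd z hzD hz2
    exact inner_cuspFormsToLp_eq_zero_of_ae_eq_truncation_level_cm_two L μ ν h𝓕N h𝓕c 𝔓 i h𝔓 hφc hφM hφN hφB hT hz2 hC (F z) hv (hTr z.re hz2) φ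
  have hD : ∀ z ∈ D, ⟪w, F z⟫_ℂ = 0 := inner_eq_zero_of_differentiableOn hDo hDc hFd w hσ₀D hseed
  have hind0 : ⟪w, ind⟫_ℂ = 0 := by
    have hm := memLp_quotFun_siegelIndicator (F := (↥(maximalRealSubfield L))) (E := L) (c := (IsCMField.complexConj L)) (N := 2) μ 2 T
    rw [hind hm]
    exact inner_cuspFormsToLp_eq_zero_of_ae_eq_siegelIndicator_cm_two L μ ν h𝓕N h𝓕c 𝔓 i h𝔓 hT _ hm.coeFn_toLp φ
  have hV : Tendsto (fun z : ℂ => (z - 1) • F z + κ • ind) (𝓝[≠] 1) (𝓝 (Res + κ • ind)) := hRes.add tendsto_const_nhds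
  have h0 : ∀ᶠ z in 𝓝[≠] (1 : ℂ), ⟪w, (z - 1) • F z + κ • ind⟫_ℂ = 0 := by
    filter_upwards [hD1] with z hz
    rw [inner_add_right, inner_smul_right, inner_smul_right, hD z hz, hind0, mul_zero, mul_zero, add_zero]
  exact inner_eq_zero_symm.1 (inner_eq_zero_of_tendsto w hV h0)

/-- **(L-ORTH) AT LEVEL `K′`, ONE-RADICAL DATUM** — §2's head at `𝔓₀ = ⟨PUnit, fun _ => N(𝔸)⟩` (`i := PUnit.unit`, `h𝔓 := rfl`): the conclusion is the TYPE of the letter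
`horth` of ★ T1 `K2E1EisensteinResidueLevelConstantU2.residueValue_eq_const_of_letters_cm_two` token for token (`(ind) (hind) (c := κ)`).
[cite: MoeglinWaldspurger1995, IV.1.11] [cite: BernsteinLapid2019, §4 Claim 2] -/
theorem horth_level_cm_two_of_letters₀
    (ν : Measure ↥(adelicUnipotent (↥(maximalRealSubfield L)) L (IsCMField.complexConj L) 2)) [ν.IsHaarMeasure]
    {𝓕 : Set ↥(adelicUnipotent (↥(maximalRealSubfield L)) L (IsCMField.complexConj L) 2)}
    (h𝓕N : IsFundamentalDomain ↥(rationalUnipotent (↥(maximalRealSubfield L)) L (IsCMField.complexConj L) 2) 𝓕 ν) (h𝓕c : IsCompact (closure 𝓕))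
    {φ₁ : (quasiSplit (↥(maximalRealSubfield L)) L (IsCMField.complexConj L) 2).Adelic → ℂ} (hφc : Continuous φ₁) {M : ℝ} (hφM : ∀ x, ‖φ₁ x‖ ≤ M)
    (hφN : ∀ (u : ↥(adelicUnipotent (↥(maximalRealSubfield L)) L (IsCMField.complexConj L) 2)) (x : (quasiSplit (↥(maximalRealSubfield L)) L (IsCMField.complexConj L) 2).Adelic),
      φ₁ ((u : (quasiSplit (↥(maximalRealSubfield L)) L (IsCMField.complexConj L) 2).Adelic) * x) = φ₁ x)
    (hφB : ∀ b ∈ borelU ((IsCMField.complexConj L : L ≃ₐ[↥(maximalRealSubfield L)] L) : L →+* L) ((StdForm.antidiagonal 2).over L),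
      ∀ x : (quasiSplit (↥(maximalRealSubfield L)) L (IsCMField.complexConj L) 2).Adelic,
        φ₁ ((quasiSplit (↥(maximalRealSubfield L)) L (IsCMField.complexConj L) 2).toAdelic b * x) = φ₁ x)
    {T : ℝ≥0} (hT : 1 ≤ T)
    (Ec : ℂ → (quasiSplit (↥(maximalRealSubfield L)) L (IsCMField.complexConj L) 2).Adelic → ℂ) {D : Set ℂ} (hDo : IsOpen D) (hDc : IsPreconnected D)
    {σ₀ : ℝ} (hσ₀ : 1 < σ₀) (hσD : ∀ᶠ z in 𝓝 ((σ₀ : ℝ) : ℂ), z ∈ D) (hD1 : ∀ᶠ z in 𝓝[≠] (1 : ℂ), z ∈ D)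
    (hE2 : ∀ z ∈ D, 1 < z.re → Ec z = eisensteinSeriesU (flatSectionU φ₁ z))
    (hMbd : ∀ z ∈ D, 1 < z.re → ∃ C : ℝ, ∀ g : (quasiSplit (↥(maximalRealSubfield L)) L (IsCMField.complexConj L) 2).Adelic, T < borelHeight g →
      ‖borelConstantTerm ν 𝓕 (eisensteinSeriesU (flatSectionU φ₁ z)) g - flatSectionU φ₁ z g‖ ≤ C)
    (hTr : ∀ σ : ℝ, 1 < σ → MemLp ((quasiSplit (↥(maximalRealSubfield L)) L (IsCMField.complexConj L) 2).quotFun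
      (truncation ν 𝓕 T (eisensteinSeriesU (flatSectionU (fun _ : (quasiSplit (↥(maximalRealSubfield L)) L (IsCMField.complexConj L) 2).Adelic => ((M : ℝ) : ℂ)) ((σ : ℝ) : ℂ))))) 2 μ)
    (F : ℂ → (quasiSplit (↥(maximalRealSubfield L)) L (IsCMField.complexConj L) 2).L2 μ) (hFd : DifferentiableOn ℂ F D)
    (hFam : ∀ z ∈ D, ((F z : (quasiSplit (↥(maximalRealSubfield L)) L (IsCMField.complexConj L) 2).L2 μ) : (quasiSplit (↥(maximalRealSubfield L)) L (IsCMField.complexConj L) 2).automorphicQuotient → ℂ) =ᵐ[μ]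
      (quasiSplit (↥(maximalRealSubfield L)) L (IsCMField.complexConj L) 2).quotFun (truncation ν 𝓕 T (Ec z)))
    (Res : (quasiSplit (↥(maximalRealSubfield L)) L (IsCMField.complexConj L) 2).L2 μ) (hRes : Tendsto (fun z : ℂ => (z - 1) • F z) (𝓝[≠] 1) (𝓝 Res))
    (ind : (quasiSplit (↥(maximalRealSubfield L)) L (IsCMField.complexConj L) 2).L2 μ)
    (hind : ∀ hm : MemLp ((quasiSplit (↥(maximalRealSubfield L)) L (IsCMField.complexConj L) 2).quotFun fun t =>
      if T < supHeight (↥(maximalRealSubfield L)) L (IsCMField.complexConj L) 2 ((quasiSplit (↥(maximalRealSubfield L)) L (IsCMField.complexConj L) 2).toAutomorphicQuotient t⁻¹) then (1 : ℂ) else 0) 2 μ,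
      ind = hm.toLp _)
    (κ : ℂ) :
    ∀ φ : ↥((quasiSplit (↥(maximalRealSubfield L)) L (IsCMField.complexConj L) 2).cuspForms μ (⟨PUnit, fun _ => adelicUnipotent (↥(maximalRealSubfield L)) L (IsCMField.complexConj L) 2⟩ : (quasiSplit (↥(maximalRealSubfield L)) L (IsCMField.complexConj L) 2).ParabolicUnipotentData)),
      ⟪Res + κ • ind, (quasiSplit (↥(maximalRealSubfield L)) L (IsCMField.complexConj L) 2).cuspFormsToLp μ (⟨PUnit, fun _ => adelicUnipotent (↥(maximalRealSubfield L)) L (IsCMField.complexConj L) 2⟩ : (quasiSplit (↥(maximalRealSubfield L)) L (IsCMField.complexConj L) 2).ParabolicUnipotentData) φ⟫_ℂ = 0 :=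
  horth_level_cm_two_of_letters L μ ν h𝓕N h𝓕c (⟨PUnit, fun _ => adelicUnipotent (↥(maximalRealSubfield L)) L (IsCMField.complexConj L) 2⟩ : (quasiSplit (↥(maximalRealSubfield L)) L (IsCMField.complexConj L) 2).ParabolicUnipotentData) PUnit.unit rfl hφc hφM hφN hφB hT Ec hDo hDc hσ₀ hσD hD1 hE2 hMbd hTr F hFd hFam Res hRes ind hind κ

end Head

end Summit.HodgeConjecture.HodgeConjecture.Cruxes.H413.K2E1TruncatedEisensteinCuspOrthogonalLevelCMTwo

end
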